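import Summits.NavierStokesRegularity.FunctionalMining.TopEigMixProductionTwo
import HarnessLib

/-!
# FunctionalMining — K1-Q6 (a) at the row `q = 2`: the mixtures `Φ₂ + ε ℰ` obey the saturating
# law `T_LD` (`σ = 1`, `γ = 3`) for EVERY `ε > 0`, with the rate exponent `5`

Search for candidate a priori estimates; no regularity claim. Cell `pub-nsfunc`, prove seat
(gen 24). The `q = 2` row of the dictionary's candidate law `TopEigStrainMixLaw q ε`
(`SpectralMixtureCandidates`; escape (a) of the no-go door D-K6), complementing
`TopEigStrainMixLawHolds` (real `q > 2`): at `q = 2` the strain moment is the enstrophy,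
`Z₂ = ∫|S|² = ℰ` (`torusStrainMoment_two`), and the absorbing dissipation is `ν‖Δu‖₂²` of the
`H¹` balance `dℰ/dt = −ν‖Δu‖₂² + ∫⟪(u·∇)u, Δu⟫`
(`Torus.IsClassicalNSSolutionOn.hasDerivWithinAt_half_gradNormSq`).

MECHANISM. Right derivative of `Φ₂(u(s))` at `t`: `R_Φ ≤ −ν T₂ + 𝒩₊ ≤ 𝒩₊ ≤ C₁ E^{3/4} L^{3/4}`
(`TopEigProductionSplit`, heat sieve, `TopEigMixProductionTwo`; `E = ‖∇u‖₂² = 2ℰ`, `L = ‖Δu‖₂²`);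
`ℰ' = −ν L + X`, `|X| ≤ K₂ E^{3/4} L^{3/4}` (`Torus.abs_integral_inner_convect_laplacian_le`); so with
`C₀ = C₁ + K₂`: `F_ε' ≤ C₀(1+ε) E^{3/4} L^{3/4} − εν L ≤ (C₀(1+ε))⁴ (εν)^{−3} E³` (Young), and
`E³ = E·E² ≤ 4 ε^{−2} E F_ε²` (`F_ε ≥ εℰ = εE/2`): the budget `4 (C₀(1+ε))⁴ ε^{−5} ν^{−3} (2ℰ) F_ε²`,
rate exponent `5 = (5q−5)/(2q−3)` at `q = 2`.

* **`TopEig.exists_topEigStrainMix_two_rightDeriv_le`** — the right derivative and its budget;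
* `TopEig.continuousWithinAt_topEigStrainMix_two` — continuity of `F_ε(u(s))` within the window;
* **`TopEig.exists_topEigStrainMix_two_rate_le`** — every one-sided derivative value within the
  window obeys the budget (fence + Dini fencing, `TopEigStrainMixDeriv`);
* **`TopEig.topEigStrainMixLaw_two`** — `0 < ε → TopEigStrainMixLaw 2 ε` on `T³`;
* **`TopEig.topEigStrainMixRate_two`** — `TopEigStrainMixRate 2 5` on `T³`.

With `TopEigStrainMixLawHolds` this covers all three rows `q = 2, 3, 4` of `ES.lam1.q` in mixture
form. Constants existential (Ladyzhenskaya, pressure-Hessian Calderón–Zygmund at `2`, the tree's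
enstrophy-production constant). Nothing here is about Navier–Stokes regularity. [ours]
-/

noncomputable section

open MeasureTheory Set Filter Topology Finset
open scoped InnerProductSpace

namespace Summit.NavierStokesRegularity.FunctionalMining

open Literature.Analysis.FunctionSpaces Literature.Analysis.FluidPDE

namespace TopEig

open StrainL4 StrainMoment VorticityL4 StrainTensor Torus

/-- **The right derivative of `F_ε = Φ₂ + ε Z₂` along Navier–Stokes and its `T_LD` budget
(`q = 2`).** There is `C₀ ≥ 0` such that for every `ε > 0`, every `ν > 0` and every classical
solution of unforced Navier–Stokes on `T³ × [a, b]`, at every `t ∈ [a, b)`: `s ↦ F_ε(u(s))` has a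
right derivative `R` within `[t, ∞)` with
`R ≤ 4 (C₀(1+ε))⁴ ε^{−5} ν^{−3} (2ℰ(u t)) F_ε(u t)²`. [ours] -/
theorem exists_topEigStrainMix_two_rightDeriv_le :
    ∃ C₀ : ℝ, 0 ≤ C₀ ∧ ∀ {ε : ℝ}, 0 < ε → ∀ {ν a b : ℝ}, 0 < ν → a < b →
      ∀ {u : ℝ → UnitAddTorus (Fin 3) → EuclideanSpace ℝ (Fin 3)} {p : ℝ → UnitAddTorus (Fin 3) → ℝ},
      Torus.IsClassicalNSSolutionOn (Icc a b) ν 0 u p → ∀ {t : ℝ}, t ∈ Ico a b →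
      ∃ R : ℝ, HasDerivWithinAt (fun s => topEigStrainMix 2 ε (u s)) R (Ici t) t ∧
        R ≤ 4 * (C₀ * (1 + ε)) ^ (4 : ℝ) * ε ^ (-(5 : ℝ)) * ν ^ (-(3 : ℝ)) *
          ((2 * torusEnstrophy (u t)) * topEigStrainMix 2 ε (u t) ^ 2) := by
  obtain ⟨K₁, hK₁⟩ := Torus.integral_sum_norm_sq_partialDeriv_sq_le (d := Fin 3) (by simp)
  obtain ⟨CP, hCP0, hCP⟩ := exists_hess_rpow (d := Fin 3) (q := 2) (by norm_num)
  obtain ⟨K₂, hK₂⟩ := Torus.abs_integral_inner_convect_laplacian_le (d := Fin 3) (by simp)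
  have hK₁0 : (0 : ℝ) ≤ K₁ := NNReal.coe_nonneg K₁
  have hK₂0 : (0 : ℝ) ≤ K₂ := NNReal.coe_nonneg K₂
  obtain ⟨C₁, hC₁⟩ : ∃ C : ℝ, C = 2 * (2 * (81 * CP + 1) * K₁) ^ (1 / 2 : ℝ) := ⟨_, rfl⟩
  have hC₁0 : 0 ≤ C₁ := by rw [hC₁]; positivity
  refine ⟨C₁ + K₂, add_nonneg hC₁0 hK₂0, ?_⟩
  intro ε hε ν a b hν hab u p hsol t ht
  have ht' : t ∈ Icc a b := ⟨ht.1, ht.2.le⟩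
  have h12 : (1 : ℝ) ≤ 2 := by norm_num
  have hut : IsSmooth (u t) := hsol.smooth_velocity.isSmooth_slice ht'
  have hdiv : IsDivFree (u t) := hsol.divFree t ht'
  obtain ⟨E, hE⟩ : ∃ E : ℝ, E = gradNormSq (u t) := ⟨_, rfl⟩
  obtain ⟨L, hL⟩ : ∃ L : ℝ, L = ∫ x, ‖Torus.laplacian (u t) x‖ ^ 2 := ⟨_, rfl⟩
  have hE0 : 0 ≤ E := by rw [hE]; exact gradNormSq_nonneg _
  have hL0 : 0 ≤ L := by rw [hL]; exact integral_nonneg fun x => sq_nonneg _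
  have hEns : torusEnstrophy (u t) = 2⁻¹ * E := by rw [hE]; rfl
  -- the right derivative of `Φ₂`, transport-free, with the heat sieve
  obtain ⟨RΦ, hRΦ, hRΦle, -⟩ := hasDerivWithinAt_topEigMoment_le_heat_add_production hν.le hsol hab h12 ht
  have hT0 : 0 ≤ heatDissipation (torusTopEigMoment 2) (u t) :=
    heatDissipation_nonneg_of_admissible h12 convexOn_lam lipschitzWith_lam
      (fun _ hv hdv x => lam_strainFlat_nonneg hv hdv x)
      (fun _ hv hdv => torusTopEigMoment_eq hv hdv 2) hut hdiv
  have hNPeq : ∫ x, 2 * torusStrainTopEig (u t) x ^ ((2 : ℝ) - 1) * dirTopEig (strainFlat (u t) x)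
      (-pressVec (p t) x + strainFlat ((0 : ℝ → UnitAddTorus (Fin 3) → EuclideanSpace ℝ (Fin 3)) t) x -
        nonlinVec (u t) x) = ∫ x, 2 * torusStrainTopEig (u t) x ^ ((2 : ℝ) - 1) *
      dirTopEig (strainFlat (u t) x) (-pressVec (p t) x - nonlinVec (u t) x) :=
    integral_congr_ae (ae_of_all _ fun x => by simp only [Pi.zero_apply, strainFlat_zero, add_zero])
  have hNP := eulerProduction_two_le hK₁0 hCP0 hK₁ hsol (fun s hs i j => hCP hab hsol s hs i j) ht'
  rw [← hE, ← hL, ← hC₁] at hNP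
  have hRΦ' : RΦ ≤ C₁ * E ^ (3 / 4 : ℝ) * L ^ (3 / 4 : ℝ) := by
    rw [hNPeq] at hRΦle
    have hneg : -(ν * heatDissipation (torusTopEigMoment 2) (u t)) ≤ 0 := by
      have := mul_nonneg hν.le hT0; linarith
    calc RΦ ≤ _ := hRΦle
      _ ≤ 0 + C₁ * E ^ (3 / 4 : ℝ) * L ^ (3 / 4 : ℝ) := add_le_add hneg hNP
      _ = _ := zero_add _
  -- the enstrophy derivative within the window, moved to `[t, ∞)`
  obtain ⟨X, hX⟩ : ∃ X : ℝ, X = ∫ x, ⟪Torus.convect (u t) (u t) x, Torus.laplacian (u t) x⟫_ℝ := ⟨_, rfl⟩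
  have hXle : X ≤ K₂ * E ^ (3 / 4 : ℝ) * L ^ (3 / 4 : ℝ) := by
    rw [hX, hE, hL]; exact (le_abs_self _).trans (hK₂ (u t) hut hdiv)
  have hEder0 := hsol.hasDerivWithinAt_half_gradNormSq hab ht'
  have hXeq : ∫ x, ⟪Torus.convect (u t) (u t) x -
      (0 : ℝ → UnitAddTorus (Fin 3) → EuclideanSpace ℝ (Fin 3)) t x, Torus.laplacian (u t) x⟫_ℝ = X := by
    rw [hX]; exact integral_congr_ae (ae_of_all _ fun x => by simp only [Pi.zero_apply, sub_zero])
  have hEder : HasDerivWithinAt (fun s => torusEnstrophy (u s)) (-ν * L + X) (Ici t) t := by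
    have h1 : HasDerivWithinAt (fun s => torusEnstrophy (u s)) (-ν * L + X) (Icc a b) t := by
      rw [hL, ← hXeq]; exact hEder0
    have hmem : Icc a b ∈ 𝓝[Ici t] t := by
      have h2 : Ici t ∩ Iio b ∈ 𝓝[Ici t] t := inter_mem_nhdsWithin _ (Iio_mem_nhds ht.2)
      exact Filter.mem_of_superset h2 fun y hy => ⟨ht.1.trans hy.1, hy.2.le⟩
    exact h1.mono_of_mem_nhdsWithin hmem
  -- the right derivative of `F_ε` (on `[t, b)` the strain moment `Z₂` is the enstrophy)
  have hΦder : HasDerivWithinAt (fun s => torusTopEigMoment 2 (u s)) RΦ (Ici t) t :=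
    hasDerivWithinAt_Ioi_iff_Ici.1 hRΦ
  have hGder : HasDerivWithinAt (fun s => torusTopEigMoment 2 (u s) + ε * torusEnstrophy (u s))
      (RΦ + ε * (-ν * L + X)) (Ici t) t := hΦder.add (hEder.const_mul ε)
  have hFder : HasDerivWithinAt (fun s => topEigStrainMix 2 ε (u s)) (RΦ + ε * (-ν * L + X)) (Ici t) t := by
    refine hGder.congr_of_eventuallyEq ?_ ?_
    · have h2 : Ici t ∩ Iio b ∈ 𝓝[Ici t] t := inter_mem_nhdsWithin _ (Iio_mem_nhds ht.2)
      filter_upwards [h2] with s hs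
      have hsI : s ∈ Icc a b := ⟨ht.1.trans hs.1, hs.2.le⟩
      show topEigStrainMix 2 ε (u s) = torusTopEigMoment 2 (u s) + ε * torusEnstrophy (u s)
      rw [topEigStrainMix, torusStrainMoment_two (hsol.smooth_velocity.isSmooth_slice hsI) (hsol.divFree s hsI)]
    · show topEigStrainMix 2 ε (u t) = torusTopEigMoment 2 (u t) + ε * torusEnstrophy (u t)
      rw [topEigStrainMix, torusStrainMoment_two hut hdiv]
  refine ⟨RΦ + ε * (-ν * L + X), hFder, ?_⟩
  -- Young with the weight `εν`
  have hεν : 0 < ε * ν := mul_pos hε hν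
  have hC0 : 0 ≤ (C₁ + K₂) * (1 + ε) := mul_nonneg (add_nonneg hC₁0 hK₂0) (by linarith)
  have hstep1 : RΦ + ε * (-ν * L + X) ≤ (C₁ + K₂) * (1 + ε) * E ^ (3 / 4 : ℝ) * L ^ (3 / 4 : ℝ) - ε * ν * L := by
    have hP0 : 0 ≤ E ^ (3 / 4 : ℝ) * L ^ (3 / 4 : ℝ) := mul_nonneg (Real.rpow_nonneg hE0 _) (Real.rpow_nonneg hL0 _)
    have h1 : ε * X ≤ ε * (K₂ * E ^ (3 / 4 : ℝ) * L ^ (3 / 4 : ℝ)) := mul_le_mul_of_nonneg_left hXle hε.le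
    have h2 : C₁ * E ^ (3 / 4 : ℝ) * L ^ (3 / 4 : ℝ) + ε * (K₂ * E ^ (3 / 4 : ℝ) * L ^ (3 / 4 : ℝ)) ≤
        (C₁ + K₂) * (1 + ε) * E ^ (3 / 4 : ℝ) * L ^ (3 / 4 : ℝ) := by
      have e1 : (C₁ + K₂) * (1 + ε) * E ^ (3 / 4 : ℝ) * L ^ (3 / 4 : ℝ) =
          C₁ * E ^ (3 / 4 : ℝ) * L ^ (3 / 4 : ℝ) + ε * (K₂ * E ^ (3 / 4 : ℝ) * L ^ (3 / 4 : ℝ)) +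
          (ε * C₁ + K₂) * (E ^ (3 / 4 : ℝ) * L ^ (3 / 4 : ℝ)) := by ring
      rw [e1]
      have : 0 ≤ (ε * C₁ + K₂) * (E ^ (3 / 4 : ℝ) * L ^ (3 / 4 : ℝ)) :=
        mul_nonneg (add_nonneg (mul_nonneg hε.le hC₁0) hK₂0) hP0
      linarith
    have e2 : RΦ + ε * (-ν * L + X) = RΦ + ε * X - ε * ν * L := by ring
    rw [e2]
    linarith
  have hM0 : 0 ≤ E ^ 3 := pow_nonneg hE0 3
  have hY := VorticityMoment.young_rpow (a := 3 / 4) (by norm_num) (by norm_num) hC0 hL0 hM0 hεν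
  have hE34 : (E ^ 3) ^ ((1 : ℝ) - 3 / 4) = E ^ (3 / 4 : ℝ) := by
    rw [← Real.rpow_natCast E 3, ← Real.rpow_mul hE0]; norm_num
  rw [hE34] at hY
  have hexp1 : (1 : ℝ) / (1 - 3 / 4) = 4 := by norm_num
  have hexp2 : -((3 : ℝ) / 4 / (1 - 3 / 4)) = -3 := by norm_num
  rw [hexp1, hexp2] at hY
  have hstep2 : RΦ + ε * (-ν * L + X) ≤ ((C₁ + K₂) * (1 + ε)) ^ (4 : ℝ) * (ε * ν) ^ (-(3 : ℝ)) * E ^ 3 := by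
    linarith
  -- `E³ ≤ 4 ε^{-2} E F_ε²`
  have hFε0 : 0 ≤ topEigStrainMix 2 ε (u t) := topEigStrainMix_nonneg hε.le _
  have hEle : E ≤ 2 * ε⁻¹ * topEigStrainMix 2 ε (u t) := by
    rw [topEigStrainMix, torusStrainMoment_two hut hdiv, hEns]
    have hΦ0 := torusTopEigMoment_nonneg 2 (u t)
    have hε0 : ε ≠ 0 := hε.ne'
    have e : 2 * ε⁻¹ * (ε * (2⁻¹ * E)) = E := by field_simp
    rw [mul_add, e]
    have : 0 ≤ 2 * ε⁻¹ * torusTopEigMoment 2 (u t) := by positivity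
    linarith
  have hE3 : E ^ 3 ≤ E * (4 * ε ^ (-(2 : ℝ)) * topEigStrainMix 2 ε (u t) ^ 2) := by
    have h1 : E ^ 2 ≤ (2 * ε⁻¹ * topEigStrainMix 2 ε (u t)) ^ 2 := pow_le_pow_left₀ hE0 hEle 2
    have e1 : (2 * ε⁻¹ * topEigStrainMix 2 ε (u t)) ^ 2 = 4 * ε ^ (-(2 : ℝ)) * topEigStrainMix 2 ε (u t) ^ 2 := by
      rw [Real.rpow_neg hε.le, Real.rpow_two]; ring
    rw [e1] at h1
    calc E ^ 3 = E * E ^ 2 := by ring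
      _ ≤ _ := mul_le_mul_of_nonneg_left h1 hE0
  have hA0 : 0 ≤ ((C₁ + K₂) * (1 + ε)) ^ (4 : ℝ) * (ε * ν) ^ (-(3 : ℝ)) :=
    mul_nonneg (Real.rpow_nonneg hC0 _) (Real.rpow_nonneg hεν.le _)
  have hstep3 : RΦ + ε * (-ν * L + X) ≤ ((C₁ + K₂) * (1 + ε)) ^ (4 : ℝ) * (ε * ν) ^ (-(3 : ℝ)) *
      (E * (4 * ε ^ (-(2 : ℝ)) * topEigStrainMix 2 ε (u t) ^ 2)) :=
    hstep2.trans (mul_le_mul_of_nonneg_left hE3 hA0)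
  have e2 : (ε * ν) ^ (-(3 : ℝ)) = ε ^ (-(3 : ℝ)) * ν ^ (-(3 : ℝ)) := Real.mul_rpow hε.le hν.le
  have e3 : ε ^ (-(5 : ℝ)) = ε ^ (-(3 : ℝ)) * ε ^ (-(2 : ℝ)) := by
    rw [← Real.rpow_add hε]; norm_num
  have e4 : 2 * torusEnstrophy (u t) = E := by rw [hEns]; ring
  rw [e3, e4]
  calc RΦ + ε * (-ν * L + X) ≤ _ := hstep3
    _ = 4 * ((C₁ + K₂) * (1 + ε)) ^ (4 : ℝ) * (ε ^ (-(3 : ℝ)) * ε ^ (-(2 : ℝ))) * ν ^ (-(3 : ℝ)) *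
        (E * topEigStrainMix 2 ε (u t) ^ 2) := by rw [e2]; ring

/-- `s ↦ F_ε(u(s)) = Φ₂ + ε Z₂` is continuous within the window along a classical solution. [ours] -/
theorem continuousWithinAt_topEigStrainMix_two (ε : ℝ) {ν a b : ℝ} (hab : a < b)
    {u : ℝ → UnitAddTorus (Fin 3) → EuclideanSpace ℝ (Fin 3)} {p : ℝ → UnitAddTorus (Fin 3) → ℝ}
    (hsol : Torus.IsClassicalNSSolutionOn (Icc a b) ν 0 u p) {t : ℝ} (ht : t ∈ Icc a b) :
    ContinuousWithinAt (fun s => topEigStrainMix 2 ε (u s)) (Icc a b) t := by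
  have hU : UniqueDiffOn ℝ (Icc a b) := uniqueDiffOn_Icc hab
  have hu : Torus.IsSmoothSpaceTimeOn (Icc a b) u := hsol.smooth_velocity
  have hΦ : ContinuousWithinAt (fun s => torusTopEigMoment 2 (u s)) (Icc a b) t :=
    (continuousOn_integral_comp_strain hU hu continuous_lam (by norm_num : (0 : ℝ) ≤ 2)).congr
      (fun s hs => torusTopEigMoment_eq (hu.isSmooth_slice hs) (hsol.divFree s hs) 2) t ht
  have hE : ContinuousWithinAt (fun s => torusEnstrophy (u s)) (Icc a b) t :=
    (hsol.hasDerivWithinAt_half_gradNormSq hab ht).continuousWithinAt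
  have hZ : ContinuousWithinAt (fun s => torusStrainMoment 2 (u s)) (Icc a b) t :=
    hE.congr (fun s hs => torusStrainMoment_two (hu.isSmooth_slice hs) (hsol.divFree s hs))
      (torusStrainMoment_two (hu.isSmooth_slice ht) (hsol.divFree t ht))
  exact hΦ.add (continuousWithinAt_const.mul hZ)

/-- **K1-Q6 (a) at `q = 2` in derivative-value form.** There is `C₀ ≥ 0` such that for every
`ε > 0`, along every classical solution of unforced Navier–Stokes on `T³` (`ν > 0`), every one-sided
derivative value `R` of `s ↦ F_ε(u(s))` within the window satisfies
`R ≤ 4 (C₀(1+ε))⁴ ε^{−5} ν^{−3} (2ℰ) F_ε²`. [ours] -/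
theorem exists_topEigStrainMix_two_rate_le :
    ∃ C₀ : ℝ, 0 ≤ C₀ ∧ ∀ {ε : ℝ}, 0 < ε → ∀ {ν a b : ℝ}, 0 < ν → a < b →
      ∀ {u : ℝ → UnitAddTorus (Fin 3) → EuclideanSpace ℝ (Fin 3)} {p : ℝ → UnitAddTorus (Fin 3) → ℝ},
      Torus.IsClassicalNSSolutionOn (Icc a b) ν 0 u p →
      ∀ t ∈ Icc a b, ∀ R : ℝ, HasDerivWithinAt (fun s => topEigStrainMix 2 ε (u s)) R (Icc a b) t →
        R ≤ 4 * (C₀ * (1 + ε)) ^ (4 : ℝ) * ε ^ (-(5 : ℝ)) * ν ^ (-(3 : ℝ)) *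
          ((2 * torusEnstrophy (u t)) * topEigStrainMix 2 ε (u t) ^ 2) := by
  obtain ⟨C₀, hC₀, hder⟩ := exists_topEigStrainMix_two_rightDeriv_le
  refine ⟨C₀, hC₀, ?_⟩
  intro ε hε ν a b hν hab u p hsol t ht R hR
  set κ : ℝ := 4 * (C₀ * (1 + ε)) ^ (4 : ℝ) * ε ^ (-(5 : ℝ)) * ν ^ (-(3 : ℝ)) with hκ
  set bud : ℝ → ℝ := fun s => κ * ((2 * torusEnstrophy (u s)) * topEigStrainMix 2 ε (u s) ^ 2)
    with hbud
  show R ≤ bud t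
  have hcont : ContinuousWithinAt bud (Icc a b) t := by
    have hE : ContinuousWithinAt (fun s => torusEnstrophy (u s)) (Icc a b) t :=
      (hsol.hasDerivWithinAt_half_gradNormSq hab ht).continuousWithinAt
    have hF := continuousWithinAt_topEigStrainMix_two ε hab hsol ht
    exact continuousWithinAt_const.mul ((continuousWithinAt_const.mul hE).mul (hF.pow 2))
  have hfence : ∀ ⦃t₁ t₂ : ℝ⦄, t₁ ∈ Icc a b → t₂ ∈ Icc a b → t₁ ≤ t₂ → ∀ ⦃K : ℝ⦄,
      (∀ σ ∈ Icc t₁ t₂, bud σ ≤ K) →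
      topEigStrainMix 2 ε (u t₂) - topEigStrainMix 2 ε (u t₁) ≤ K * (t₂ - t₁) := by
    intro t₁ t₂ ht₁ ht₂ hle K hK
    have hcontF : ContinuousOn (fun s => topEigStrainMix 2 ε (u s)) (Icc t₁ t₂) := fun s hs =>
      (continuousWithinAt_topEigStrainMix_two ε hab hsol ⟨ht₁.1.trans hs.1, hs.2.trans ht₂.2⟩).mono
        (Icc_subset_Icc ht₁.1 ht₂.2)
    have hD : ∀ x ∈ Ico t₁ t₂, ∃ R' : ℝ,
        HasDerivWithinAt (fun s => topEigStrainMix 2 ε (u s)) R' (Ici x) x ∧ R' ≤ K := by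
      intro x hx
      have hxab : x ∈ Ico a b := ⟨ht₁.1.trans hx.1, lt_of_lt_of_le hx.2 ht₂.2⟩
      obtain ⟨R', hR', hle'⟩ := hder hε hν hab hsol hxab
      exact ⟨R', hR', hle'.trans (hK x ⟨hx.1, hx.2.le⟩)⟩
    choose! f' hf' hf'le using hD
    exact sub_le_mul_of_deriv_right_le hle hcontF (fun x hx => hf' x hx) (fun x hx => hf'le x hx)
  exact hasDerivWithinAt_le_of_fence hab ht hcont hfence hR

/-- **K1-Q6 (a) HOLDS at the row `q = 2` for every `ε > 0`: `TopEigStrainMixLaw 2 ε` on `T³`** —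
`F_ε = ∫(λ₁⁺)²(S) + ε ∫|S|²` obeys `T_LD` with `σ = 1`, `γ = 3`:
`R ≤ κ(ε) ν^{−3} (2ℰ) F_ε²` for every one-sided derivative value along zero-mean classical
solutions of unforced Navier–Stokes; small-data closing only; no regularity claim. [ours] -/
theorem topEigStrainMixLaw_two {ε : ℝ} (hε : 0 < ε) : TopEigStrainMixLaw (d := Fin 3) 2 ε := by
  obtain ⟨C₀, hC₀, h⟩ := exists_topEigStrainMix_two_rate_le
  refine ⟨4 * (C₀ * (1 + ε)) ^ (4 : ℝ) * ε ^ (-(5 : ℝ)), ?_, ?_⟩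
  · exact mul_nonneg (mul_nonneg (by norm_num) (Real.rpow_nonneg (mul_nonneg hC₀ (by linarith)) _))
      (Real.rpow_nonneg hε.le _)
  · intro _ ν hν a b hab u p hsol _ t ht R hR
    have h1 := h hε hν hab hsol t ht R hR
    have e1 : ((3 : ℝ) * 2 - 3) / (2 * 2 - 3) = 3 := by norm_num
    have e2 : (1 : ℝ) + (2 * 2 - 3)⁻¹ = 2 := by norm_num
    rw [e1, e2, Real.rpow_two]
    calc R ≤ _ := h1
      _ = _ := by ring

/-- **The dictionary number of K1-Q6 (a) at `q = 2` is at most `5`:** `TopEigStrainMixRate 2 5` on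
`T³` — for `ε ∈ (0, 1]` the law for `F_ε` holds with constant `C ε^{−5}`, `C = 4 (2C₀)⁴`
(`= (5q−5)/(2q−3)` at `q = 2`, matching `TopEigStrainMixLawHolds` for `q > 2`). [ours] -/
theorem topEigStrainMixRate_two : TopEigStrainMixRate (d := Fin 3) 2 5 := by
  obtain ⟨C₀, hC₀, h⟩ := exists_topEigStrainMix_two_rate_le
  refine ⟨4 * (2 * C₀) ^ (4 : ℝ), 1, one_pos, ?_⟩
  intro ε hε hε1 _ ν hν a b hab u p hsol _ t ht R hR
  have h1 := h hε hν hab hsol t ht R hR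
  have e1 : ((3 : ℝ) * 2 - 3) / (2 * 2 - 3) = 3 := by norm_num
  have e2 : (1 : ℝ) + (2 * 2 - 3)⁻¹ = 2 := by norm_num
  rw [e1, e2, Real.rpow_two]
  have hpow : (C₀ * (1 + ε)) ^ (4 : ℝ) ≤ (2 * C₀) ^ (4 : ℝ) :=
    Real.rpow_le_rpow (mul_nonneg hC₀ (by linarith)) (by nlinarith) (by norm_num)
  have hx : 0 ≤ ε ^ (-(5 : ℝ)) * ν ^ (-(3 : ℝ)) *
      ((2 * torusEnstrophy (u t)) * topEigStrainMix 2 ε (u t) ^ 2) :=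
    mul_nonneg (mul_nonneg (Real.rpow_nonneg hε.le _) (Real.rpow_nonneg hν.le _))
      (mul_nonneg (mul_nonneg (by norm_num) (torusEnstrophy_nonneg _)) (sq_nonneg _))
  calc R ≤ 4 * (C₀ * (1 + ε)) ^ (4 : ℝ) * (ε ^ (-(5 : ℝ)) * ν ^ (-(3 : ℝ)) *
        ((2 * torusEnstrophy (u t)) * topEigStrainMix 2 ε (u t) ^ 2)) := by
        calc R ≤ _ := h1
          _ = _ := by ring
    _ ≤ 4 * (2 * C₀) ^ (4 : ℝ) * (ε ^ (-(5 : ℝ)) * ν ^ (-(3 : ℝ)) *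
        ((2 * torusEnstrophy (u t)) * topEigStrainMix 2 ε (u t) ^ 2)) :=
        mul_le_mul_of_nonneg_right (mul_le_mul_of_nonneg_left hpow (by norm_num)) hx
    _ = _ := by ring

end TopEig

end Summit.NavierStokesRegularity.FunctionalMining

end
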